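import Summits.Ventures.LatticeQCDFlow.Exactness.FlowSamplerSymmetrisation
import Summits.Ventures.LatticeQCDFlow.Exactness.FlowSamplerGroupSymmetrisation
import Summits.Ventures.LatticeQCDFlow.Exactness.Phi4FlowSymmetrisedSampler
import HarnessLib

/-!
# Symmetrising or mixing flows is free for REWEIGHTING too: the reweighting variance of the
# symmetrised flow is at most the orbit average (hence never larger on parity-homogeneous observables),
# and that of a mixture of flows is at most the weighted average — observable by observable

HONEST FRAMING: exact (Metropolis-corrected) sampling algorithms for lattice gauge theory;
figures of merit are autocorrelation/cost numbers at stated couplings and volumes; no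
continuum-physics claim.  (SCALAR calibration rung S0-A: not a gauge result.)

Venture `LatticeQCDFlow` (cell pub-lqcd), topic `Exactness`; FANOUT row 2 (`s0-phi4`, FLOW arm).
NEW WORK of the cell (pointwise AM–HM / Cauchy–Schwarz and one change of variables; nothing is cited
as a fact; no definition).  GEN-22/23 typed that replacing a flow `q̃` by its symmetrisation
`q̃ₛ = ½(q̃ + q̃∘σ)` (or a group average, or a mixture `Σ αᵢ q̃ᵢ`) never lowers acceptance, ESS
(`W₂ = ∫ w²/q̃` never up: `symmetrised_weightMoment_le`, `finMixture_weightMoment_le`) or overlap and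
never raises either KL.  This session's files compare the exact chain with REWEIGHTING, whose
figure of merit is observable-dependent: `σ²_RW(g) = Z⁻² ∫ g² w²/q̃` (`g` centred; row 4's
`SelfNormalisedReweightingCLT`, row 2's `Phi4FlowReweightingCLT`).  Here the same convexity,
weighted by `g²`: for the SYMMETRISED flow and a measure-preserving involution `σ` with `w∘σ = w`,
**`∫ g² w²/q̃ₛ ≤ ½(∫ g² w²/q̃ + ∫ (g∘σ)² w²/q̃)`** for every measurable `g` (so `≤ ∫ g² w²/q̃` whenever
`(g∘σ)² = g²` — every even or odd observable, e.g. `M`, `M²`, the energy under the global flip);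
for a MIXTURE `q̄ = Σ αᵢ q̃ᵢ`, **`∫ g² w²/q̄ ≤ Σ αᵢ ∫ g² w²/q̃ᵢ` for EVERY `g`** (HM ≤ AM pointwise).
Reading: symmetrising or pooling flows cannot make the reweighting error bar of any
parity-homogeneous (resp. any) observable worse than the (average of the) originals — it is free
for both published estimators, accept/reject (GEN-22/23) and reweighting (this file).

## What is proved

* `one_div_convexComb_le` — `αᵢ ≥ 0`, `Σ αᵢ = 1`, `qᵢ > 0` ⇒ `1/(Σ αᵢ qᵢ) ≤ Σ αᵢ/qᵢ` (Cauchy–Schwarz);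
* **`symmetrised_reweightMoment_le_orbitAvg`** — `σ` a measure-preserving involution, `w > 0`,
  `w∘σ = w`, `q̃ > 0`; `g` measurable with `g² w²/q̃, (g∘σ)² w²/q̃ ∈ L¹`:
  `g² w²/q̃ₛ ∈ L¹` and `∫ g² w²/q̃ₛ ≤ ½ (∫ g² w²/q̃ + ∫ (g∘σ)² w²/q̃)`;
  **`symmetrised_reweightMoment_le`** — if moreover `(g∘σ)² = g²`: `∫ g² w²/q̃ₛ ≤ ∫ g² w²/q̃`;
* **`finMixture_reweightMoment_le_avg`** — `αᵢ > 0`, `Σ αᵢ = 1`, `q̃ᵢ > 0` measurable, `g` measurable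
  with every `g² w²/q̃ᵢ ∈ L¹`: `g² w²/q̄ ∈ L¹` and `∫ g² w²/q̄ ≤ Σ αᵢ ∫ g² w²/q̃ᵢ`;
* **`groupAvg_reweightMoment_le`** — finite family of measure-preserving symmetries `tᵢ` with
  `w ∘ tᵢ = w`, `q̄ = |ι|⁻¹ Σ q̃ ∘ tᵢ`: for every `g` with `g ∘ tᵢ = χᵢ g`, `χᵢ² = 1`:
  `∫ g² w²/q̄ ≤ ∫ g² w²/q̃` (every symmetry SECTOR; GEN-23's `FlowSamplerGroupSymmetrisation*`
  proved the chain-side statements);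
* lattice φ⁴ (`λ > 0`, real `J`, ANY flow `q̃`, the global flip `φ ↦ −φ`):
  **`phi4FlowSym_reweightMoment_le`** — for every measurable `f` whose CENTRED square is
  flip-invariant (`(f(−φ) − ⟨f⟩)² = (f(φ) − ⟨f⟩)²`: every even `f`; every odd `f`, as then `⟨f⟩ = 0`)
  with `(f − ⟨f⟩)² e^{−2S}/q̃ ∈ L¹`: `∫ (f − ⟨f⟩)² e^{−2S}/q̃ₛ ≤ ∫ (f − ⟨f⟩)² e^{−2S}/q̃`.

NOT CLAIMED: strictness; any comparison of the symmetrised flow with the BEST element of the orbit;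
cost (two density evaluations per draw); any value for any network; anything for the HMC / local arms.
-/

namespace Summit.Ventures.LatticeQCDFlow.Exactness

open Real MeasureTheory Filter Finset Set Topology
open Summit.Ventures.LatticeQCDFlow.Scoring

/-! ## §0 HM ≤ AM for a convex combination -/

/-- **`1/(Σ αᵢ qᵢ) ≤ Σ αᵢ/qᵢ`** for `αᵢ ≥ 0` with `Σ αᵢ = 1` and `qᵢ > 0` (Cauchy–Schwarz:
`1 = (Σ αᵢ)² = (Σ √(αᵢqᵢ) √(αᵢ/qᵢ))² ≤ (Σ αᵢ qᵢ)(Σ αᵢ/qᵢ)`). -/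
theorem one_div_convexComb_le {ι : Type*} (s : Finset ι) {α x : ι → ℝ} (hα : ∀ i ∈ s, 0 ≤ α i)
    (hα1 : ∑ i ∈ s, α i = 1) (hx : ∀ i ∈ s, 0 < x i) :
    1 / (∑ i ∈ s, α i * x i) ≤ ∑ i ∈ s, α i / x i := by
  have hcs := Finset.sum_mul_sq_le_sq_mul_sq s (fun i => Real.sqrt (α i * x i))
    (fun i => Real.sqrt (α i / x i))
  have e1 : ∑ i ∈ s, Real.sqrt (α i * x i) * Real.sqrt (α i / x i) = 1 := by
    rw [← hα1]
    refine Finset.sum_congr rfl fun i hi => ?_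
    rw [← Real.sqrt_mul (mul_nonneg (hα i hi) (hx i hi).le)]
    have e : α i * x i * (α i / x i) = α i ^ 2 := by
      field_simp [(hx i hi).ne']
    rw [e, Real.sqrt_sq (hα i hi)]
  have e2 : ∑ i ∈ s, Real.sqrt (α i * x i) ^ 2 = ∑ i ∈ s, α i * x i :=
    Finset.sum_congr rfl fun i hi => Real.sq_sqrt (mul_nonneg (hα i hi) (hx i hi).le)
  have e3 : ∑ i ∈ s, Real.sqrt (α i / x i) ^ 2 = ∑ i ∈ s, α i / x i :=
    Finset.sum_congr rfl fun i hi => Real.sq_sqrt (div_nonneg (hα i hi) (hx i hi).le)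
  rw [e1, e2, e3, one_pow] at hcs
  have hB : 0 ≤ ∑ i ∈ s, α i / x i := Finset.sum_nonneg fun i hi => div_nonneg (hα i hi) (hx i hi).le
  have hA : 0 < ∑ i ∈ s, α i * x i := by
    by_contra h
    push Not at h
    nlinarith
  rw [div_le_iff₀ hA]
  linarith [mul_comm (∑ i ∈ s, α i * x i) (∑ i ∈ s, α i / x i)]

/-! ## §1 The symmetrised flow: orbit average and parity-homogeneous observables -/

section Symm

variable {X : Type*} [MeasurableSpace X] {μ : Measure X} {σ : X → X} {w q : X → ℝ}

omit [MeasurableSpace X] in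
/-- Pointwise: `g² w²/q̃ₛ ≤ ½ (g² w²/q̃ + g² w²/(q̃∘σ))` (AM–HM). -/
theorem sq_weightSq_div_symmetrised_le (hw0 : ∀ t, 0 < w t) (hq0 : ∀ t, 0 < q t) (g : X → ℝ)
    (x : X) :
    g x ^ 2 * (w x / ((q x + q (σ x)) / 2) * w x)
      ≤ (g x ^ 2 * (w x / q x * w x) + g x ^ 2 * (w x / q (σ x) * w x)) / 2 := by
  have h := one_div_midpoint_le (hq0 x) (hq0 (σ x))
  have hgw : 0 ≤ g x ^ 2 * (w x * w x) := mul_nonneg (sq_nonneg _) (mul_pos (hw0 x) (hw0 x)).le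
  have e1 : g x ^ 2 * (w x / ((q x + q (σ x)) / 2) * w x)
      = g x ^ 2 * (w x * w x) * (1 / ((q x + q (σ x)) / 2)) := by ring
  have e2 : (g x ^ 2 * (w x / q x * w x) + g x ^ 2 * (w x / q (σ x) * w x)) / 2
      = g x ^ 2 * (w x * w x) * ((1 / q x + 1 / q (σ x)) / 2) := by ring
  rw [e1, e2]
  exact mul_le_mul_of_nonneg_left h hgw

/-- **`∫ g² w²/q̃ₛ ≤ ½ (∫ g² w²/q̃ + ∫ (g∘σ)² w²/q̃)`** — the reweighting variance numerator of the
symmetrised flow is at most the ORBIT AVERAGE of the original's, for every measurable `g` with both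
orbit terms integrable (`σ` a measure-preserving involution, `w∘σ = w`); integrability included. -/
theorem symmetrised_reweightMoment_le_orbitAvg (hσ : MeasurePreserving σ μ μ)
    (hσσ : ∀ x, σ (σ x) = x) (hw0 : ∀ t, 0 < w t) (hwm : Measurable w) (hw : ∀ t, w (σ t) = w t)
    (hq0 : ∀ t, 0 < q t) (hqm : Measurable q) {g : X → ℝ} (hgm : Measurable g)
    (hg : Integrable (fun x => g x ^ 2 * (w x / q x * w x)) μ)
    (hgσ : Integrable (fun x => g (σ x) ^ 2 * (w x / q x * w x)) μ) :
    Integrable (fun x => g x ^ 2 * (w x / ((q x + q (σ x)) / 2) * w x)) μ ∧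
    ∫ x, g x ^ 2 * (w x / ((q x + q (σ x)) / 2) * w x) ∂μ
      ≤ ((∫ x, g x ^ 2 * (w x / q x * w x) ∂μ) + ∫ x, g (σ x) ^ 2 * (w x / q x * w x) ∂μ) / 2 := by
  -- the second orbit term, transported: `∫ g² w²/(q∘σ) = ∫ (g∘σ)² w²/q`
  have hF : Integrable (fun x => g x ^ 2 * (w x / q (σ x) * w x)) μ := by
    have h := integrable_comp_involution hσ hσσ hgσ
    exact h.congr (Eventually.of_forall fun x => by simp only [hσσ, hw])
  have hFint : ∫ x, g x ^ 2 * (w x / q (σ x) * w x) ∂μ = ∫ x, g (σ x) ^ 2 * (w x / q x * w x) ∂μ := by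
    rw [← integral_comp_involution hσ hσσ (fun x => g (σ x) ^ 2 * (w x / q x * w x))]
    exact integral_congr_ae (Eventually.of_forall fun x => by simp only [hσσ, hw])
  have hnn : ∀ x, 0 ≤ g x ^ 2 * (w x / ((q x + q (σ x)) / 2) * w x) := fun x =>
    mul_nonneg (sq_nonneg _) (mul_nonneg (div_pos (hw0 x)
      (div_pos (add_pos (hq0 x) (hq0 _)) two_pos)).le (hw0 x).le)
  have hdom : Integrable (fun x => (g x ^ 2 * (w x / q x * w x)
      + g x ^ 2 * (w x / q (σ x) * w x)) / 2) μ := (hg.add hF).div_const 2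
  have hmeas : Measurable fun x => g x ^ 2 * (w x / ((q x + q (σ x)) / 2) * w x) :=
    (hgm.pow_const 2).mul ((hwm.div ((hqm.add (hqm.comp hσ.measurable)).div_const 2)).mul hwm)
  have hint : Integrable (fun x => g x ^ 2 * (w x / ((q x + q (σ x)) / 2) * w x)) μ := by
    refine Integrable.mono' hdom hmeas.aestronglyMeasurable (Eventually.of_forall fun x => ?_)
    rw [Real.norm_eq_abs, abs_of_nonneg (hnn x)]
    exact sq_weightSq_div_symmetrised_le hw0 hq0 g x
  refine ⟨hint, ?_⟩
  calc ∫ x, g x ^ 2 * (w x / ((q x + q (σ x)) / 2) * w x) ∂μ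
      ≤ ∫ x, (g x ^ 2 * (w x / q x * w x) + g x ^ 2 * (w x / q (σ x) * w x)) / 2 ∂μ :=
        integral_mono hint hdom fun x => sq_weightSq_div_symmetrised_le hw0 hq0 g x
    _ = ((∫ x, g x ^ 2 * (w x / q x * w x) ∂μ) + ∫ x, g (σ x) ^ 2 * (w x / q x * w x) ∂μ) / 2 := by
        rw [integral_div, integral_add hg hF, hFint]

/-- **`∫ g² w²/q̃ₛ ≤ ∫ g² w²/q̃` FOR EVERY PARITY-HOMOGENEOUS OBSERVABLE** (`(g∘σ)² = g²`: even or odd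
`g`): symmetrising the flow never raises the reweighting variance of such an observable. -/
theorem symmetrised_reweightMoment_le (hσ : MeasurePreserving σ μ μ) (hσσ : ∀ x, σ (σ x) = x)
    (hw0 : ∀ t, 0 < w t) (hwm : Measurable w) (hw : ∀ t, w (σ t) = w t) (hq0 : ∀ t, 0 < q t)
    (hqm : Measurable q) {g : X → ℝ} (hgm : Measurable g) (hgsq : ∀ x, g (σ x) ^ 2 = g x ^ 2)
    (hg : Integrable (fun x => g x ^ 2 * (w x / q x * w x)) μ) :
    Integrable (fun x => g x ^ 2 * (w x / ((q x + q (σ x)) / 2) * w x)) μ ∧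
    ∫ x, g x ^ 2 * (w x / ((q x + q (σ x)) / 2) * w x) ∂μ ≤ ∫ x, g x ^ 2 * (w x / q x * w x) ∂μ := by
  have hgσ : Integrable (fun x => g (σ x) ^ 2 * (w x / q x * w x)) μ :=
    hg.congr (Eventually.of_forall fun x => by simp only [hgsq])
  obtain ⟨hint, hle⟩ := symmetrised_reweightMoment_le_orbitAvg hσ hσσ hw0 hwm hw hq0 hqm hgm hg hgσ
  refine ⟨hint, hle.trans_eq ?_⟩
  have e : ∫ x, g (σ x) ^ 2 * (w x / q x * w x) ∂μ = ∫ x, g x ^ 2 * (w x / q x * w x) ∂μ :=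
    integral_congr_ae (Eventually.of_forall fun x => by simp only [hgsq])
  rw [e]
  ring

end Symm

/-! ## §2 Mixtures of flows: HM ≤ AM, weighted by `g²` -/

section Mixture

variable {X : Type*} [MeasurableSpace X] {μ : Measure X} {w : X → ℝ}
  {ι : Type*} [Fintype ι] {q : ι → X → ℝ} {α : ι → ℝ}

/-- **`∫ g² w²/q̄ ≤ Σ αᵢ ∫ g² w²/q̃ᵢ` FOR EVERY OBSERVABLE**, `q̄ = Σ αᵢ q̃ᵢ` (`αᵢ > 0`, `Σ αᵢ = 1`,
`q̃ᵢ > 0` measurable; `g` measurable with each `g² w²/q̃ᵢ ∈ L¹`): the reweighting variance of the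
pooled flow is at most the weighted average of the components'; integrability included. -/
theorem finMixture_reweightMoment_le_avg [Nonempty ι] (hα : ∀ i, 0 < α i) (hα1 : ∑ i, α i = 1)
    (hw0 : ∀ t, 0 < w t) (hwm : Measurable w) (hq0 : ∀ i x, 0 < q i x)
    (hqm : ∀ i, Measurable (q i)) {g : X → ℝ} (hgm : Measurable g)
    (hg : ∀ i, Integrable (fun x => g x ^ 2 * (w x / q i x * w x)) μ) :
    Integrable (fun x => g x ^ 2 * (w x / (∑ i, α i * q i x) * w x)) μ ∧
    ∫ x, g x ^ 2 * (w x / (∑ i, α i * q i x) * w x) ∂μ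
      ≤ ∑ i, α i * ∫ x, g x ^ 2 * (w x / q i x * w x) ∂μ := by
  have hmix0 : ∀ x, 0 < ∑ i, α i * q i x := fun x =>
    Finset.sum_pos (fun i _ => mul_pos (hα i) (hq0 i x)) Finset.univ_nonempty
  have hpt : ∀ x, g x ^ 2 * (w x / (∑ i, α i * q i x) * w x)
      ≤ ∑ i, α i * (g x ^ 2 * (w x / q i x * w x)) := by
    intro x
    have h := one_div_convexComb_le Finset.univ (fun i _ => (hα i).le) hα1 (fun i _ => hq0 i x)
    have hgw : 0 ≤ g x ^ 2 * (w x * w x) := mul_nonneg (sq_nonneg _) (mul_pos (hw0 x) (hw0 x)).le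
    have e1 : g x ^ 2 * (w x / (∑ i, α i * q i x) * w x)
        = g x ^ 2 * (w x * w x) * (1 / ∑ i, α i * q i x) := by ring
    have e2 : ∑ i, α i * (g x ^ 2 * (w x / q i x * w x))
        = g x ^ 2 * (w x * w x) * ∑ i, α i / q i x := by
      rw [Finset.mul_sum]
      refine Finset.sum_congr rfl fun i _ => ?_
      ring
    rw [e1, e2]
    exact mul_le_mul_of_nonneg_left h hgw
  have hnn : ∀ x, 0 ≤ g x ^ 2 * (w x / (∑ i, α i * q i x) * w x) := fun x =>
    mul_nonneg (sq_nonneg _) (mul_nonneg (div_pos (hw0 x) (hmix0 x)).le (hw0 x).le)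
  have hdom : Integrable (fun x => ∑ i, α i * (g x ^ 2 * (w x / q i x * w x))) μ :=
    integrable_finsetSum Finset.univ fun i _ => (hg i).const_mul _
  have hmeas : Measurable fun x => g x ^ 2 * (w x / (∑ i, α i * q i x) * w x) :=
    (hgm.pow_const 2).mul ((hwm.div (Finset.measurable_sum _ fun i _ => (hqm i).const_mul _)).mul
      hwm)
  have hint : Integrable (fun x => g x ^ 2 * (w x / (∑ i, α i * q i x) * w x)) μ := by
    refine Integrable.mono' hdom hmeas.aestronglyMeasurable (Eventually.of_forall fun x => ?_)
    rw [Real.norm_eq_abs, abs_of_nonneg (hnn x)]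
    exact hpt x
  refine ⟨hint, ?_⟩
  calc ∫ x, g x ^ 2 * (w x / (∑ i, α i * q i x) * w x) ∂μ
      ≤ ∫ x, ∑ i, α i * (g x ^ 2 * (w x / q i x * w x)) ∂μ := integral_mono hint hdom hpt
    _ = ∑ i, α i * ∫ x, g x ^ 2 * (w x / q i x * w x) ∂μ := by
        rw [integral_finsetSum Finset.univ fun i _ => (hg i).const_mul _]
        refine Finset.sum_congr rfl fun i _ => ?_
        rw [integral_const_mul]

end Mixture

/-! ## §2b Group averaging: symmetry sectors -/

section Group

variable {X : Type*} [MeasurableSpace X] {μ : Measure X} {w q : X → ℝ}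
  {ι : Type*} [Fintype ι] [Nonempty ι] {t : ι → X ≃ᵐ X}

/-- **`∫ g² w²/q̄ ≤ ∫ g² w²/q̃` ON EVERY SYMMETRY SECTOR** for the group-averaged flow
`q̄ = |ι|⁻¹ Σᵢ q̃ ∘ tᵢ` (`tᵢ` measure preserving, `w ∘ tᵢ = w`): for every measurable `g` with
`g ∘ tᵢ = χᵢ g`, `χᵢ² = 1` (invariant or sign-covariant observables) and `g² w²/q̃ ∈ L¹`, the
reweighting variance of the averaged flow is at most the original's (HM ≤ AM + one change of
variables per symmetry; no group law needed). -/
theorem groupAvg_reweightMoment_le (ht : ∀ i, MeasurePreserving (t i) μ μ) (hw0 : ∀ x, 0 < w x)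
    (hwm : Measurable w) (hw : ∀ i x, w (t i x) = w x) (hq0 : ∀ x, 0 < q x) (hqm : Measurable q)
    {g : X → ℝ} (hgm : Measurable g) {χ : ι → ℝ} (hg : ∀ i x, g (t i x) = χ i * g x)
    (hχ : ∀ i, χ i ^ 2 = 1) (hgi : Integrable (fun x => g x ^ 2 * (w x / q x * w x)) μ) :
    Integrable (fun x => g x ^ 2 * (w x / ((∑ i, q (t i x)) / Fintype.card ι) * w x)) μ ∧
    ∫ x, g x ^ 2 * (w x / ((∑ i, q (t i x)) / Fintype.card ι) * w x) ∂μ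
      ≤ ∫ x, g x ^ 2 * (w x / q x * w x) ∂μ := by
  have hN : (0 : ℝ) < Fintype.card ι := by exact_mod_cast Fintype.card_pos
  -- each orbit term is the original, transported along `tᵢ`
  have hterm : ∀ i, (fun x => g x ^ 2 * (w x / q (t i x) * w x))
      = fun x => (fun y => g y ^ 2 * (w y / q y * w y)) (t i x) := by
    intro i; funext x
    simp only [hg i x, hw i x, mul_pow, hχ i, one_mul]
  have hgi' : ∀ i, Integrable (fun x => g x ^ 2 * (w x / q (t i x) * w x)) μ := fun i => by
    rw [hterm i]; exact integrable_comp_symmetry ht i hgi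
  have hint_i : ∀ i, ∫ x, g x ^ 2 * (w x / q (t i x) * w x) ∂μ = ∫ x, g x ^ 2 * (w x / q x * w x) ∂μ :=
    fun i => by rw [hterm i]; exact integral_comp_symmetry ht i (fun y => g y ^ 2 * (w y / q y * w y))
  -- the uniform mixture of the transported flows
  obtain ⟨hint, hle⟩ := finMixture_reweightMoment_le_avg (μ := μ) (w := w)
    (q := fun i x => q (t i x)) (α := fun _ => 1 / (Fintype.card ι : ℝ))
    (fun _ => by positivity) (by
      rw [Finset.sum_const, Finset.card_univ, nsmul_eq_mul]; field_simp)
    hw0 hwm (fun i x => hq0 _) (fun i => hqm.comp (t i).measurable) hgm hgi'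
  have e : ∀ x, (∑ i, 1 / (Fintype.card ι : ℝ) * q (t i x)) = (∑ i, q (t i x)) / Fintype.card ι :=
    fun x => by rw [← Finset.mul_sum]; field_simp
  have e' : (fun x => g x ^ 2 * (w x / (∑ i, 1 / (Fintype.card ι : ℝ) * q (t i x)) * w x))
      = fun x => g x ^ 2 * (w x / ((∑ i, q (t i x)) / Fintype.card ι) * w x) := by
    funext x; rw [e x]
  rw [e'] at hint hle
  refine ⟨hint, hle.trans_eq ?_⟩
  simp only [hint_i]
  rw [← Finset.sum_mul, Finset.sum_const, Finset.card_univ, nsmul_eq_mul]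
  field_simp

end Group

/-! ## §3 Lattice φ⁴: the global flip -/

section Lattice

variable {n : ℕ}

/-- **SYMMETRISING A FLOW UNDER THE GLOBAL FLIP NEVER RAISES THE REWEIGHTING VARIANCE OF AN EVEN OR
ODD OBSERVABLE** (`λ > 0`, real `J`, ANY positive measurable flow density `q̃`, `q̃ₛ(φ) = ½(q̃(φ) + q̃(−φ))`):
for every measurable `f` whose centred square is flip-invariant (`(f(−φ) − ⟨f⟩)² = (f(φ) − ⟨f⟩)²`:
every even `f`, and every odd `f` since then `⟨f⟩ = 0`) with `(f − ⟨f⟩)² e^{−S}(e^{−S}/q̃) ∈ L¹`: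
`∫ (f − ⟨f⟩)² e^{−S} (e^{−S}/q̃ₛ) ≤ ∫ (f − ⟨f⟩)² e^{−S} (e^{−S}/q̃)` — i.e. `σ²_RW(f; q̃ₛ) ≤ σ²_RW(f; q̃)`. -/
theorem phi4FlowSym_reweightMoment_le (J : Fin (n + 1) → Fin (n + 1) → ℝ) (lam : ℝ)
    {q : (Fin (n + 1) → ℝ) → ℝ} (hq0 : ∀ φ, 0 < q φ) (hqm : Measurable q)
    {f : (Fin (n + 1) → ℝ) → ℝ} (hfm : Measurable f)
    (hfsq : ∀ φ, (f (-φ) - gibbsExpect J lam f) ^ 2 = (f φ - gibbsExpect J lam f) ^ 2)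
    (hfb : Integrable (fun φ => (f φ - gibbsExpect J lam f) ^ 2
      * (gibbsWeight J lam φ / q φ * gibbsWeight J lam φ))) :
    Integrable (fun φ => (f φ - gibbsExpect J lam f) ^ 2
      * (gibbsWeight J lam φ / ((q φ + q (-φ)) / 2) * gibbsWeight J lam φ)) ∧
    ∫ φ, (f φ - gibbsExpect J lam f) ^ 2
        * (gibbsWeight J lam φ / ((q φ + q (-φ)) / 2) * gibbsWeight J lam φ)
      ≤ ∫ φ, (f φ - gibbsExpect J lam f) ^ 2 * (gibbsWeight J lam φ / q φ * gibbsWeight J lam φ) :=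
  symmetrised_reweightMoment_le (μ := volume) (σ := fun ψ : Fin (n + 1) → ℝ => -ψ)
    measurePreserving_neg_pi (fun φ => neg_neg φ) (fun φ => gibbsWeight_pos J lam φ)
    (continuous_gibbsWeight J lam).measurable (fun φ => gibbsWeight_neg J lam φ) hq0 hqm
    (hfm.sub measurable_const) hfsq hfb

end Lattice

end Summit.Ventures.LatticeQCDFlow.Exactness
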